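import Summits.ValiantsHypothesis.ValiantsHypothesis.Theorems.KPlusLogSqLawTropicalBMatchingStability
import Summits.ValiantsHypothesis.ValiantsHypothesis.Theorems.KPlusLogSqLawTropicalBMatchingTies

/-!
# Route «KPlusLogSqLaw», crux `TropicalB` (stmt-ValiantsHypothesis-19771) — MANY VERTEX FLIPS: the unique minimum-weight matching of a
# box `E ∩ (Ua × Ub)` moves its count by at most one and its coverage by at most two per flipped row/column

HONEST FRAMING.  Helper toward the registered stubs `stub_tropThin` / `stub_tropFat` of `Cruxes/TropicalB/Lines/birth.lean`
(crux `Summit.ValiantsHypothesis.ValiantsHypothesis.Theses.KPlusLogSqLaw.TropicalB`, item stmt-ValiantsHypothesis-19771, route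
KPlusLogSqLaw; cell `pub-symmetroid`, seat val-sym-trop-p1 g8, 2026-08-27; `--supports … --as helper`).  A COMBINATORIAL ENGINE;
nothing here bounds `TropicalB` or bears on `WeakLifting`, DoorA26 / DoorA34, `MatrixDescartes` (stmt-ValiantsHypothesis-18050) or
VP ≠ VNP.

THE POINT (memo SEPARATED-LEVELS-g8.md, Lemma 4 for K ≥ 4 levels).  A level of the lexicographic tower lives on a BOX: the present cells
`E` of its class restricted to the rows `Ua` and columns `Ub` left free by the higher levels.  Between two consecutive chain slopes the box
changes by some flipped rows and columns (deleted AND added).  If every box has a UNIQUE minimum-weight matching (the «half-integer digit»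
sector of …SeparatedTower, where all level thresholds are half-integers), then iterating the one-vertex stability of
…TropicalBMatchingStability gives `box_flips`:

* the count moves by at most the number of flipped vertices in each direction
  (`|M| ≤ |M'| + #(rows/cols removed)`, `|M'| ≤ |M| + #(rows/cols added)`), and
* the coverage moves by at most two vertices per flip: `|dom M Δ dom M'| + |rng M Δ rng M'| ≤ 2·(#flipped rows + #flipped columns)`.
[folklore]
-/

set_option linter.dupNamespace false
set_option autoImplicit false

namespace Summit.ValiantsHypothesis.ValiantsHypothesis.Theorems.KPlusLogSqLaw

namespace MatchingExchange

open Finset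
open scoped BigOperators
open Literature.Computability.MetaComplexity.PBij

variable {α β : Type*} [DecidableEq α] [DecidableEq β]

/-- deleting a row from the box is filtering the box. [folklore] -/
theorem box_erase_row (E : Finset (α × β)) (Ua : Finset α) (Ub : Finset β) (v : α) :
    E.filter (fun e => e.1 ∈ Ua.erase v ∧ e.2 ∈ Ub) = (E.filter (fun e => e.1 ∈ Ua ∧ e.2 ∈ Ub)).filter (fun e => e.1 ≠ v) := by
  ext e; simp only [Finset.mem_filter, Finset.mem_erase]; tauto

/-- deleting a column from the box is filtering the box. [folklore] -/
theorem box_erase_col (E : Finset (α × β)) (Ua : Finset α) (Ub : Finset β) (v : β) :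
    E.filter (fun e => e.1 ∈ Ua ∧ e.2 ∈ Ub.erase v) = (E.filter (fun e => e.1 ∈ Ua ∧ e.2 ∈ Ub)).filter (fun e => e.2 ≠ v) := by
  ext e; simp only [Finset.mem_filter, Finset.mem_erase]; tauto

/-- **ONE ROW FLIP.**  `M` the unique minimiser on the box of `(Ua, Ub)`, `M'` the unique minimiser on the box of `(Ua.erase v, Ub)`:
the counts differ by at most one (`|M'| ≤ |M| ≤ |M'| + 1`) and the coverages by at most two vertices. [folklore] -/
theorem flip_row {E M M' : Finset (α × β)} {Ua : Finset α} {Ub : Finset β} {v : α} {w : α × β → ℤ}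
    (hM : IsPMatching M) (hMG : M ⊆ E.filter (fun e => e.1 ∈ Ua ∧ e.2 ∈ Ub))
    (hmin : ∀ X : Finset (α × β), IsPMatching X → X ⊆ E.filter (fun e => e.1 ∈ Ua ∧ e.2 ∈ Ub) → ∑ e ∈ M, w e ≤ ∑ e ∈ X, w e)
    (huniq : ∀ X : Finset (α × β), IsPMatching X → X ⊆ E.filter (fun e => e.1 ∈ Ua ∧ e.2 ∈ Ub) →
      ∑ e ∈ X, w e ≤ ∑ e ∈ M, w e → X = M)
    (hM' : IsPMatching M') (hM'G : M' ⊆ E.filter (fun e => e.1 ∈ Ua.erase v ∧ e.2 ∈ Ub))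
    (hmin' : ∀ X : Finset (α × β), IsPMatching X → X ⊆ E.filter (fun e => e.1 ∈ Ua.erase v ∧ e.2 ∈ Ub) →
      ∑ e ∈ M', w e ≤ ∑ e ∈ X, w e)
    (huniq' : ∀ X : Finset (α × β), IsPMatching X → X ⊆ E.filter (fun e => e.1 ∈ Ua.erase v ∧ e.2 ∈ Ub) →
      ∑ e ∈ X, w e ≤ ∑ e ∈ M', w e → X = M') :
    M'.card ≤ M.card ∧ M.card ≤ M'.card + 1 ∧
      (dom M \ dom M').card + (dom M' \ dom M).card + (rng M \ rng M').card + (rng M' \ rng M).card ≤ 2 := by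
  rw [box_erase_row] at hM'G hmin' huniq'
  obtain ⟨h1, h2⟩ := card_stable_row hM hMG hmin huniq hM' hM'G hmin' huniq'
  refine ⟨h1, h2, ?_⟩
  by_cases hv : v ∈ dom M
  · rcases Nat.eq_or_lt_of_le h1 with hc | hc
    · -- equal counts: the row `v` is traded for one row, all columns kept
      obtain ⟨x, hvx⟩ := mem_dom.1 hv
      obtain ⟨hdom, hrng⟩ := cover_eq_row hM hMG hmin huniq hM' hM'G hmin' huniq' hc.symm hvx
      have hrng1 : rng M \ rng M' = ∅ := by rw [hrng]; simp
      have hrng2 : rng M' \ rng M = ∅ := by rw [hrng]; simp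
      -- dom M \ dom M' ⊆ {v}
      have hd1 : dom M \ dom M' ⊆ {v} := by
        intro a ha
        rw [Finset.mem_sdiff] at ha
        rw [Finset.mem_singleton]
        by_contra hav
        obtain ⟨y, hy⟩ := mem_dom.1 ha.1
        have : (a, y) ∈ M.erase (v, x) := Finset.mem_erase.2 ⟨fun h => hav (Prod.mk.inj h).1, hy⟩
        exact ha.2 (hdom (mem_dom.2 ⟨y, this⟩))
      -- |dom M'| = |dom M| so dom M' \ dom M has the same size as dom M \ dom M'
      have hcd : (dom M' \ dom M).card = (dom M \ dom M').card := by
        have e1 := Finset.card_sdiff_add_card_inter (dom M') (dom M)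
        have e2 := Finset.card_sdiff_add_card_inter (dom M) (dom M')
        rw [Finset.inter_comm] at e1
        rw [hM.card_dom, hM'.card_dom] at *
        omega
      have hle1 : (dom M \ dom M').card ≤ 1 := (Finset.card_le_card hd1).trans (by simp)
      rw [hrng1, hrng2, Finset.card_empty, hcd]
      omega
    · -- the count dropped: coverage nested, `v` and one column lost
      have hc' : M.card = M'.card + 1 := by omega
      obtain ⟨hdom, hrng, -⟩ := cover_subset_row hM hMG hmin huniq hM' hM'G hmin' huniq' hc'
      have hd2 : dom M' \ dom M = ∅ := Finset.sdiff_eq_empty_iff_subset.2 hdom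
      have hr2 : rng M' \ rng M = ∅ := Finset.sdiff_eq_empty_iff_subset.2 hrng
      have hd1 : (dom M \ dom M').card = 1 := by
        rw [Finset.card_sdiff_of_subset hdom, hM.card_dom, hM'.card_dom]; omega
      have hr1 : (rng M \ rng M').card = 1 := by
        rw [Finset.card_sdiff_of_subset hrng, hM.card_rng, hM'.card_rng]; omega
      rw [hd1, hd2, hr1, hr2]; simp
  · -- `v` unused: the two minimisers coincide
    have hMG' : M ⊆ (E.filter (fun e => e.1 ∈ Ua ∧ e.2 ∈ Ub)).filter (fun e => e.1 ≠ v) := subset_filter_row hMG hv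
    have heq : M = M' := huniq' M hM hMG' (hmin M' hM' (hM'G.trans (Finset.filter_subset _ _)))
    subst heq
    simp

/-- **ONE COLUMN FLIP.** [folklore] -/
theorem flip_col {E M M' : Finset (α × β)} {Ua : Finset α} {Ub : Finset β} {v : β} {w : α × β → ℤ}
    (hM : IsPMatching M) (hMG : M ⊆ E.filter (fun e => e.1 ∈ Ua ∧ e.2 ∈ Ub))
    (hmin : ∀ X : Finset (α × β), IsPMatching X → X ⊆ E.filter (fun e => e.1 ∈ Ua ∧ e.2 ∈ Ub) → ∑ e ∈ M, w e ≤ ∑ e ∈ X, w e)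
    (huniq : ∀ X : Finset (α × β), IsPMatching X → X ⊆ E.filter (fun e => e.1 ∈ Ua ∧ e.2 ∈ Ub) →
      ∑ e ∈ X, w e ≤ ∑ e ∈ M, w e → X = M)
    (hM' : IsPMatching M') (hM'G : M' ⊆ E.filter (fun e => e.1 ∈ Ua ∧ e.2 ∈ Ub.erase v))
    (hmin' : ∀ X : Finset (α × β), IsPMatching X → X ⊆ E.filter (fun e => e.1 ∈ Ua ∧ e.2 ∈ Ub.erase v) →
      ∑ e ∈ M', w e ≤ ∑ e ∈ X, w e)
    (huniq' : ∀ X : Finset (α × β), IsPMatching X → X ⊆ E.filter (fun e => e.1 ∈ Ua ∧ e.2 ∈ Ub.erase v) →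
      ∑ e ∈ X, w e ≤ ∑ e ∈ M', w e → X = M') :
    M'.card ≤ M.card ∧ M.card ≤ M'.card + 1 ∧
      (dom M \ dom M').card + (dom M' \ dom M).card + (rng M \ rng M').card + (rng M' \ rng M).card ≤ 2 := by
  rw [box_erase_col] at hM'G hmin' huniq'
  obtain ⟨h1, h2⟩ := card_stable_col hM hMG hmin huniq hM' hM'G hmin' huniq'
  refine ⟨h1, h2, ?_⟩
  by_cases hv : v ∈ rng M
  · rcases Nat.eq_or_lt_of_le h1 with hc | hc
    · obtain ⟨x, hxv⟩ := mem_rng.1 hv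
      obtain ⟨hrng, hdom⟩ := cover_eq_col hM hMG hmin huniq hM' hM'G hmin' huniq' hc.symm hxv
      have hdom1 : dom M \ dom M' = ∅ := by rw [hdom]; simp
      have hdom2 : dom M' \ dom M = ∅ := by rw [hdom]; simp
      have hr1 : rng M \ rng M' ⊆ {v} := by
        intro b hb
        rw [Finset.mem_sdiff] at hb
        rw [Finset.mem_singleton]
        by_contra hbv
        obtain ⟨y, hy⟩ := mem_rng.1 hb.1
        have : (y, b) ∈ M.erase (x, v) := Finset.mem_erase.2 ⟨fun h => hbv (Prod.mk.inj h).2, hy⟩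
        exact hb.2 (hrng (mem_rng.2 ⟨y, this⟩))
      have hcd : (rng M' \ rng M).card = (rng M \ rng M').card := by
        have e1 := Finset.card_sdiff_add_card_inter (rng M') (rng M)
        have e2 := Finset.card_sdiff_add_card_inter (rng M) (rng M')
        rw [Finset.inter_comm] at e1
        rw [hM.card_rng, hM'.card_rng] at *
        omega
      have hle1 : (rng M \ rng M').card ≤ 1 := (Finset.card_le_card hr1).trans (by simp)
      rw [hdom1, hdom2, Finset.card_empty, hcd]
      omega
    · have hc' : M.card = M'.card + 1 := by omega
      obtain ⟨hdom, hrng, -⟩ := cover_subset_col hM hMG hmin huniq hM' hM'G hmin' huniq' hc'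
      have hd2 : dom M' \ dom M = ∅ := Finset.sdiff_eq_empty_iff_subset.2 hdom
      have hr2 : rng M' \ rng M = ∅ := Finset.sdiff_eq_empty_iff_subset.2 hrng
      have hd1 : (dom M \ dom M').card = 1 := by
        rw [Finset.card_sdiff_of_subset hdom, hM.card_dom, hM'.card_dom]; omega
      have hr1 : (rng M \ rng M').card = 1 := by
        rw [Finset.card_sdiff_of_subset hrng, hM.card_rng, hM'.card_rng]; omega
      rw [hd1, hd2, hr1, hr2]; simp
  · have hMG' : M ⊆ (E.filter (fun e => e.1 ∈ Ua ∧ e.2 ∈ Ub)).filter (fun e => e.2 ≠ v) := subset_filter_col hMG hv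
    have heq : M = M' := huniq' M hM hMG' (hmin M' hM' (hM'G.trans (Finset.filter_subset _ _)))
    subst heq
    simp

omit [DecidableEq β] in
/-- triangle inequality for one-sided set differences. [folklore] -/
theorem card_sdiff_triangle (A B C : Finset α) : (A \ C).card ≤ (A \ B).card + (B \ C).card :=
  calc (A \ C).card ≤ ((A \ B) ∪ (B \ C)).card :=
        Finset.card_le_card (fun a ha => by
          rw [Finset.mem_sdiff] at ha; rw [Finset.mem_union, Finset.mem_sdiff, Finset.mem_sdiff]
          by_cases h : a ∈ B
          · exact Or.inr ⟨h, ha.2⟩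
          · exact Or.inl ⟨ha.1, h⟩)
    _ ≤ _ := Finset.card_union_le _ _

omit [DecidableEq α] in
/-- triangle inequality for one-sided set differences (columns). [folklore] -/
theorem card_sdiff_triangle' (A B C : Finset β) : (A \ C).card ≤ (A \ B).card + (B \ C).card :=
  calc (A \ C).card ≤ ((A \ B) ∪ (B \ C)).card :=
        Finset.card_le_card (fun a ha => by
          rw [Finset.mem_sdiff] at ha; rw [Finset.mem_union, Finset.mem_sdiff, Finset.mem_sdiff]
          by_cases h : a ∈ B
          · exact Or.inr ⟨h, ha.2⟩
          · exact Or.inl ⟨ha.1, h⟩)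
    _ ≤ _ := Finset.card_union_le _ _

omit [DecidableEq β] in
/-- erasing an element of `A ∖ A'` from `A`. [folklore] -/
theorem sdiff_erase_left {A A' : Finset α} {v : α} (hv : v ∈ A ∧ v ∉ A') :
    (A.erase v \ A').card + 1 = (A \ A').card ∧ A' \ A.erase v = A' \ A := by
  constructor
  · have e1 : A.erase v \ A' = (A \ A').erase v := by
      ext a; simp only [Finset.mem_sdiff, Finset.mem_erase]; tauto
    rw [e1, Finset.card_erase_of_mem (Finset.mem_sdiff.2 hv)]
    have : 0 < (A \ A').card := Finset.card_pos.2 ⟨v, Finset.mem_sdiff.2 hv⟩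
    omega
  · ext a
    rw [Finset.mem_sdiff, Finset.mem_sdiff, Finset.mem_erase]
    constructor
    · rintro ⟨ha, h⟩
      exact ⟨ha, fun hau => h ⟨fun hav => hv.2 (hav ▸ ha), hau⟩⟩
    · rintro ⟨ha, hna⟩
      exact ⟨ha, fun h => hna h.2⟩

omit [DecidableEq α] in
/-- erasing an element of `A ∖ A'` from `A` (columns). [folklore] -/
theorem sdiff_erase_left' {A A' : Finset β} {v : β} (hv : v ∈ A ∧ v ∉ A') :
    (A.erase v \ A').card + 1 = (A \ A').card ∧ A' \ A.erase v = A' \ A := by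
  constructor
  · have e1 : A.erase v \ A' = (A \ A').erase v := by
      ext a; simp only [Finset.mem_sdiff, Finset.mem_erase]; tauto
    rw [e1, Finset.card_erase_of_mem (Finset.mem_sdiff.2 hv)]
    have : 0 < (A \ A').card := Finset.card_pos.2 ⟨v, Finset.mem_sdiff.2 hv⟩
    omega
  · ext a
    rw [Finset.mem_sdiff, Finset.mem_sdiff, Finset.mem_erase]
    constructor
    · rintro ⟨ha, h⟩
      exact ⟨ha, fun hau => h ⟨fun hav => hv.2 (hav ▸ ha), hau⟩⟩
    · rintro ⟨ha, hna⟩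
      exact ⟨ha, fun h => hna h.2⟩

/-- **MANY FLIPS.**  If every box of `E` has a unique minimum-weight matching (for the weight `w`), then for the unique minimisers `M`,
`M'` on the boxes of `(Ua, Ub)` and `(Ua', Ub')`: the count moves by at most the number of removed (resp. added) rows and columns,
and the coverage by at most two vertices per flipped row or column. [folklore] -/
theorem box_flips {E : Finset (α × β)} {w : α × β → ℤ}
    (hU : ∀ (Ua : Finset α) (Ub : Finset β) (M₁ M₂ : Finset (α × β)),
      IsPMatching M₁ → M₁ ⊆ E.filter (fun e => e.1 ∈ Ua ∧ e.2 ∈ Ub) →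
      (∀ X : Finset (α × β), IsPMatching X → X ⊆ E.filter (fun e => e.1 ∈ Ua ∧ e.2 ∈ Ub) → ∑ e ∈ M₁, w e ≤ ∑ e ∈ X, w e) →
      IsPMatching M₂ → M₂ ⊆ E.filter (fun e => e.1 ∈ Ua ∧ e.2 ∈ Ub) →
      (∀ X : Finset (α × β), IsPMatching X → X ⊆ E.filter (fun e => e.1 ∈ Ua ∧ e.2 ∈ Ub) → ∑ e ∈ M₂, w e ≤ ∑ e ∈ X, w e) →
      M₁ = M₂) :
    ∀ (n : ℕ) (Ua Ua' : Finset α) (Ub Ub' : Finset β) (M M' : Finset (α × β)),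
      (Ua \ Ua').card + (Ua' \ Ua).card + (Ub \ Ub').card + (Ub' \ Ub).card = n →
      IsPMatching M → M ⊆ E.filter (fun e => e.1 ∈ Ua ∧ e.2 ∈ Ub) →
      (∀ X : Finset (α × β), IsPMatching X → X ⊆ E.filter (fun e => e.1 ∈ Ua ∧ e.2 ∈ Ub) → ∑ e ∈ M, w e ≤ ∑ e ∈ X, w e) →
      IsPMatching M' → M' ⊆ E.filter (fun e => e.1 ∈ Ua' ∧ e.2 ∈ Ub') →
      (∀ X : Finset (α × β), IsPMatching X → X ⊆ E.filter (fun e => e.1 ∈ Ua' ∧ e.2 ∈ Ub') → ∑ e ∈ M', w e ≤ ∑ e ∈ X, w e) →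
      M.card ≤ M'.card + (Ua \ Ua').card + (Ub \ Ub').card ∧
      M'.card ≤ M.card + (Ua' \ Ua).card + (Ub' \ Ub).card ∧
      (dom M \ dom M').card + (dom M' \ dom M).card + (rng M \ rng M').card + (rng M' \ rng M).card ≤ 2 * n := by
  -- uniqueness in the `huniq` form, from `hU`
  have huq : ∀ (Ua : Finset α) (Ub : Finset β) (M₁ : Finset (α × β)), IsPMatching M₁ → M₁ ⊆ E.filter (fun e => e.1 ∈ Ua ∧ e.2 ∈ Ub) →
      (∀ X : Finset (α × β), IsPMatching X → X ⊆ E.filter (fun e => e.1 ∈ Ua ∧ e.2 ∈ Ub) → ∑ e ∈ M₁, w e ≤ ∑ e ∈ X, w e) →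
      ∀ X : Finset (α × β), IsPMatching X → X ⊆ E.filter (fun e => e.1 ∈ Ua ∧ e.2 ∈ Ub) →
        ∑ e ∈ X, w e ≤ ∑ e ∈ M₁, w e → X = M₁ := by
    intro Ua Ub M₁ hM₁ hM₁G hmin₁ X hX hXG hle
    exact hU Ua Ub X M₁ hX hXG (fun Y hY hYG => hle.trans (hmin₁ Y hY hYG)) hM₁ hM₁G hmin₁
  -- the four triangle inequalities through an intermediate matching
  have tri : ∀ M M₁ M' : Finset (α × β),
      (dom M \ dom M').card + (dom M' \ dom M).card + (rng M \ rng M').card + (rng M' \ rng M).card ≤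
        ((dom M \ dom M₁).card + (dom M₁ \ dom M).card + (rng M \ rng M₁).card + (rng M₁ \ rng M).card) +
        ((dom M₁ \ dom M').card + (dom M' \ dom M₁).card + (rng M₁ \ rng M').card + (rng M' \ rng M₁).card) := by
    intro M M₁ M'
    have t1 := card_sdiff_triangle (dom M) (dom M₁) (dom M')
    have t2 := card_sdiff_triangle (dom M') (dom M₁) (dom M)
    have t3 := card_sdiff_triangle' (rng M) (rng M₁) (rng M')
    have t4 := card_sdiff_triangle' (rng M') (rng M₁) (rng M)
    omega
  intro n
  induction n using Nat.strong_induction_on with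
  | _ n ih =>
    intro Ua Ua' Ub Ub' M M' hn hM hMG hmin hM' hM'G hmin'
    by_cases h1 : (Ua \ Ua').Nonempty
    · -- a row of `Ua` not in `Ua'`: delete it from `Ua`
      obtain ⟨v, hv⟩ := h1
      rw [Finset.mem_sdiff] at hv
      obtain ⟨M₁, hM₁, hM₁G, hmin₁⟩ := exists_isMin (E.filter (fun e => e.1 ∈ Ua.erase v ∧ e.2 ∈ Ub)) w
      obtain ⟨c1, c2, c3⟩ := flip_row hM hMG hmin (huq _ _ M hM hMG hmin) hM₁ hM₁G hmin₁ (huq _ _ M₁ hM₁ hM₁G hmin₁)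
      obtain ⟨hA, hB⟩ := sdiff_erase_left hv
      obtain ⟨d1, d2, d3⟩ := ih (n - 1) (by omega) (Ua.erase v) Ua' Ub Ub' M₁ M' (by rw [hB]; omega) hM₁ hM₁G hmin₁ hM' hM'G hmin'
      rw [hB] at d2
      have := tri M M₁ M'
      exact ⟨by omega, by omega, by omega⟩
    by_cases h2 : (Ua' \ Ua).Nonempty
    · -- a row of `Ua'` not in `Ua`: delete it from `Ua'` (roles swapped)
      obtain ⟨v, hv⟩ := h2
      rw [Finset.mem_sdiff] at hv
      obtain ⟨M₁, hM₁, hM₁G, hmin₁⟩ := exists_isMin (E.filter (fun e => e.1 ∈ Ua'.erase v ∧ e.2 ∈ Ub')) w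
      obtain ⟨c1, c2, c3⟩ := flip_row hM' hM'G hmin' (huq _ _ M' hM' hM'G hmin') hM₁ hM₁G hmin₁ (huq _ _ M₁ hM₁ hM₁G hmin₁)
      obtain ⟨hA, hB⟩ := sdiff_erase_left hv
      obtain ⟨d1, d2, d3⟩ := ih (n - 1) (by omega) Ua (Ua'.erase v) Ub Ub' M M₁ (by rw [hB]; omega) hM hMG hmin hM₁ hM₁G hmin₁
      rw [hB] at d1
      have := tri M M₁ M'
      exact ⟨by omega, by omega, by omega⟩
    by_cases h3 : (Ub \ Ub').Nonempty
    · obtain ⟨v, hv⟩ := h3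
      rw [Finset.mem_sdiff] at hv
      obtain ⟨M₁, hM₁, hM₁G, hmin₁⟩ := exists_isMin (E.filter (fun e => e.1 ∈ Ua ∧ e.2 ∈ Ub.erase v)) w
      obtain ⟨c1, c2, c3⟩ := flip_col hM hMG hmin (huq _ _ M hM hMG hmin) hM₁ hM₁G hmin₁ (huq _ _ M₁ hM₁ hM₁G hmin₁)
      obtain ⟨hA, hB⟩ := sdiff_erase_left' hv
      obtain ⟨d1, d2, d3⟩ := ih (n - 1) (by omega) Ua Ua' (Ub.erase v) Ub' M₁ M' (by rw [hB]; omega) hM₁ hM₁G hmin₁ hM' hM'G hmin'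
      rw [hB] at d2
      have := tri M M₁ M'
      exact ⟨by omega, by omega, by omega⟩
    by_cases h4 : (Ub' \ Ub).Nonempty
    · obtain ⟨v, hv⟩ := h4
      rw [Finset.mem_sdiff] at hv
      obtain ⟨M₁, hM₁, hM₁G, hmin₁⟩ := exists_isMin (E.filter (fun e => e.1 ∈ Ua' ∧ e.2 ∈ Ub'.erase v)) w
      obtain ⟨c1, c2, c3⟩ := flip_col hM' hM'G hmin' (huq _ _ M' hM' hM'G hmin') hM₁ hM₁G hmin₁ (huq _ _ M₁ hM₁ hM₁G hmin₁)
      obtain ⟨hA, hB⟩ := sdiff_erase_left' hv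
      obtain ⟨d1, d2, d3⟩ := ih (n - 1) (by omega) Ua Ua' Ub (Ub'.erase v) M M₁ (by rw [hB]; omega) hM hMG hmin hM₁ hM₁G hmin₁
      rw [hB] at d1
      have := tri M M₁ M'
      exact ⟨by omega, by omega, by omega⟩
    -- no flips: the boxes coincide, so do the minimisers
    rw [Finset.not_nonempty_iff_eq_empty, Finset.sdiff_eq_empty_iff_subset] at h1 h2 h3 h4
    have hUa : Ua = Ua' := Finset.Subset.antisymm h1 h2
    have hUb : Ub = Ub' := Finset.Subset.antisymm h3 h4
    subst hUa; subst hUb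
    have heq : M = M' := hU Ua Ub M M' hM hMG hmin hM' hM'G hmin'
    subst heq
    simp

end MatchingExchange

end Summit.ValiantsHypothesis.ValiantsHypothesis.Theorems.KPlusLogSqLaw
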